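import Summits.ABC.StewartYu.PadicG3VbSched
import Summits.ABC.StewartYu.PadicG3RecordR2
import Summits.ABC.StewartYu.PadicG3ClosedLogs
import Summits.ABC.StewartYu.PadicG3ParVC
import Literature.NumberTheory.Transcendental.PiTranscendenceMeasureMain
import HarnessLib

/-!
# Cell abc-stewartyu, crux `Y07Odd` (stmt-ABC-19658), `m = 0` branch: the SIZES of the frame's closed forms at the record schedule
# `P.schedVb b` in p1's allowance currency (sharp `ψ(H) ≤ (23/20)·H`)

`Summits/ABC/StewartYu/PadicG3VbSizes.lean` — cell `abc-stewartyu` (seat p3-g7).  Theorems only, no named fact.  Logarithmic upper bounds of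
p2's closed forms `M0C` (with the SHARP prime-number bound `log lcm(1..H) ≤ (23/20)H`, `NWPi.log_lcmUpto_le` — the crude `(log 4 + 4)H` of
`PadicG3ClosedLogs.M0C_le` does not close the half-step budget near the `m = 0` boundary, kit HOME/p3/g7/vlines_check.py), `UcardS₂`, `XbC`/`XbSS₂`,
`monDen` of the box monomials, `AmaxS₂`, `PmaxS₂` and the k-step Liouville constant `KC`, at the schedule `Sc := P.schedVb b` (`b ≥ 1`), in terms of
p1's `PadicG3ParV*` quantities `LgV, LV, XV, L0V, HV, ŜG, htsV, lunkV`.  The node hypothesis of every family is brought to the single shape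
`|x| ≤ 2^{lev+n}·9·HV` (`g·XV/2 < 4(HV+1)`).

References: Yu. V. Nesterenko, LNM 1819 (2003) §3.1–§3.4, §4.2; Nesterenko–Waldschmidt 1996 §4 (4.2) (`ψ(H) ≤ 1.15 H` in kernel form).
-/

noncomputable section

open Finset Real
open Literature.NumberTheory.Transcendental
open Literature.NumberTheory.Transcendental.CW77.Setup (Tau tauNorm)

namespace Summit.ABC.StewartYu

namespace G3Setup

/-! ### The cleared Hasse size `M0C` with the sharp prime-number bound -/

/-- `1 ≤ M0C` (the real size inside the ceiling is `≥ 1`). [folklore] -/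
theorem one_le_M0C (L₀ H Sh lev : ℕ) (x : ℤ) (t₀ : ℕ) : (1 : ℤ) ≤ M0C L₀ H Sh lev x t₀ := by
  unfold M0C
  refine Int.one_le_ceil_iff.mpr ?_
  have hν1 : (1 : ℝ) ≤ (Nat.lcmUpto H : ℝ) := by exact_mod_cast Nat.lcmUpto_pos H
  have hr0 : (0 : ℝ) ≤ |((2 ^ (Sh - lev) * x : ℤ) : ℝ)| / H := by positivity
  have he1 : (1 : ℝ) ≤ Real.exp 1 * (1 + |((2 ^ (Sh - lev) * x : ℤ) : ℝ)| / H) := by nlinarith [Real.add_one_le_exp (1 : ℝ)]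
  have h1 : (1 : ℝ) ≤ (2 : ℝ) ^ ((Sh - lev) * t₀) := one_le_pow₀ (by norm_num)
  have h2 : (1 : ℝ) ≤ (Nat.lcmUpto H : ℝ) ^ t₀ := one_le_pow₀ hν1
  have h3 : (1 : ℝ) ≤ Real.exp (H / Real.exp 1) := Real.one_le_exp (by positivity)
  have h4 : (1 : ℝ) ≤ (Real.exp 1 * (1 + |((2 ^ (Sh - lev) * x : ℤ) : ℝ)| / H)) ^ L₀ := one_le_pow₀ he1
  have : (1 : ℝ) ≤ (2 : ℝ) ^ ((Sh - lev) * t₀) * ((Nat.lcmUpto H : ℝ) ^ t₀ *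
      (Real.exp (H / Real.exp 1) * (Real.exp 1 * (1 + |((2 ^ (Sh - lev) * x : ℤ) : ℝ)| / H)) ^ L₀)) := by
    calc (1 : ℝ) = 1 * (1 * (1 * 1)) := by ring
      _ ≤ _ := mul_le_mul h1 (mul_le_mul h2 (mul_le_mul h3 h4 (by positivity) (by positivity)) (by positivity) (by positivity))
          (by positivity) (by positivity)
  linarith

/-- `0 < M0C` (real). [folklore] -/
theorem M0C_pos (L₀ H Sh lev : ℕ) (x : ℤ) (t₀ : ℕ) : (0 : ℝ) < (M0C L₀ H Sh lev x t₀ : ℝ) := by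
  have := one_le_M0C L₀ H Sh lev x t₀
  exact_mod_cast this

/-- **`log M0C ≤ log 2 + (Ŝ−lev)·t₀·log 2 + (23/20)·H·t₀ + H/e + L₀·(1 + log(1 + 2^{Ŝ−lev}|x|/H))`** (`ψ(H) ≤ 1.15H`).
[cite: Nesterenko2003, (3.8); shape only] -/
theorem log_M0C_le_sharp (L₀ H Sh lev : ℕ) (x : ℤ) (t₀ : ℕ) :
    Real.log (M0C L₀ H Sh lev x t₀ : ℝ) ≤ Real.log 2 + ((Sh - lev : ℕ) : ℝ) * t₀ * Real.log 2 + 23 / 20 * H * t₀ + H / Real.exp 1 +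
      L₀ * (1 + Real.log (1 + |((2 ^ (Sh - lev) * x : ℤ) : ℝ)| / H)) := by
  -- the real size inside the ceiling
  set r : ℝ := |((2 ^ (Sh - lev) * x : ℤ) : ℝ)| / H with hr
  have hr0 : 0 ≤ r := by rw [hr]; positivity
  set main : ℝ := (2 : ℝ) ^ ((Sh - lev) * t₀) * ((Nat.lcmUpto H : ℝ) ^ t₀ *
    (Real.exp (H / Real.exp 1) * (Real.exp 1 * (1 + r)) ^ L₀)) with hmain
  have hν1 : (1 : ℝ) ≤ (Nat.lcmUpto H : ℝ) := by exact_mod_cast Nat.lcmUpto_pos H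
  have he1 : (1 : ℝ) ≤ Real.exp 1 * (1 + r) := by nlinarith [Real.add_one_le_exp (1 : ℝ)]
  have hmain1 : 1 ≤ main := by
    rw [hmain]
    have h1 : (1 : ℝ) ≤ (2 : ℝ) ^ ((Sh - lev) * t₀) := one_le_pow₀ (by norm_num)
    have h2 : (1 : ℝ) ≤ (Nat.lcmUpto H : ℝ) ^ t₀ := one_le_pow₀ hν1
    have h3 : (1 : ℝ) ≤ Real.exp (H / Real.exp 1) := Real.one_le_exp (by positivity)
    have h4 : (1 : ℝ) ≤ (Real.exp 1 * (1 + r)) ^ L₀ := one_le_pow₀ he1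
    calc (1 : ℝ) = 1 * (1 * (1 * 1)) := by ring
      _ ≤ _ := mul_le_mul h1 (mul_le_mul h2 (mul_le_mul h3 h4 (by positivity) (by positivity)) (by positivity) (by positivity))
          (by positivity) (by positivity)
  have hM : (M0C L₀ H Sh lev x t₀ : ℝ) ≤ 2 * main := by
    have h := Int.ceil_lt_add_one main
    unfold M0C
    rw [← hr, ← hmain]
    linarith
  have hMpos : (0 : ℝ) < (M0C L₀ H Sh lev x t₀ : ℝ) := by
    have : (1 : ℤ) ≤ M0C L₀ H Sh lev x t₀ := by
      unfold M0C; rw [← hr, ← hmain]; exact Int.one_le_ceil_iff.mpr (by linarith)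
    exact_mod_cast this
  have hlog : Real.log (M0C L₀ H Sh lev x t₀ : ℝ) ≤ Real.log 2 + Real.log main := by
    rw [← Real.log_mul (by norm_num) (by linarith)]
    exact Real.log_le_log hMpos hM
  -- `log main`
  have hψ := NWPi.log_lcmUpto_le H
  have hlogmain : Real.log main = ((Sh - lev) * t₀ : ℕ) * Real.log 2 + t₀ * Real.log (Nat.lcmUpto H) + H / Real.exp 1 +
      L₀ * (1 + Real.log (1 + r)) := by
    rw [hmain, Real.log_mul (by positivity) (by positivity), Real.log_mul (by positivity) (by positivity),
      Real.log_mul (by positivity) (by positivity), Real.log_pow, Real.log_pow, Real.log_exp, Real.log_pow,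
      Real.log_mul (by positivity) (by linarith), Real.log_exp]
    push_cast; ring
  rw [hlogmain] at hlog
  have ht0 : (0 : ℝ) ≤ t₀ := Nat.cast_nonneg _
  have := mul_le_mul_of_nonneg_left hψ ht0
  push_cast at hlog ⊢
  nlinarith [hlog, this]

end G3Setup

namespace PadicG3Par

variable {n : ℕ} (P : PadicG3Par n)

/-- `g·XV/8 = G·XV/(64(n+1))` (`G = 8(n+1)g`). [folklore] -/
theorem g_XV_div_eight : P.g * P.XV / 8 = P.G * P.XV / (64 * (n + 1)) := by
  rw [P.G_eq_mul_g]; field_simp; ring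

/-- `g·XV/2 + 1 ≤ 9·HV` (`g XV/8 < HV + 1`, `HV ≥ 1`). [folklore] -/
theorem g_XV_half_le_HV : P.g * P.XV / 2 + 1 ≤ 9 * P.HV := by
  have h := P.HV_gt
  rw [← P.g_XV_div_eight] at h
  have h1 : (1 : ℝ) ≤ P.HV := by exact_mod_cast P.one_le_HV
  linarith

/-- **`W + log LV + log 2 ≤ HV`** (`W + log(2LV) + 1 ≤ W_LV ≤ G·XV/(64(n+1)) < HV + 1`). [folklore] -/
theorem W_log_LV_le_HV : P.W + Real.log P.LV + Real.log 2 ≤ P.HV := by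
  have h1 := P.W_add_log_le_WLV
  have h2 := P.mainV_le_XV
  have h3 := P.HV_gt
  have hG : (0 : ℝ) < P.G := by linarith [P.sixteen_le_G]
  have hL : (0 : ℝ) < P.LV := by linarith [P.one_le_LV]
  have h2' : P.WLV ≤ P.G * P.XV / (64 * (n + 1)) := by
    rw [div_le_iff₀ hG] at h2
    rw [le_div_iff₀ (by positivity)]
    linarith
  rw [Real.log_mul (by norm_num) hL.ne'] at h1
  linarith

end PadicG3Par

namespace G3Setup

variable {p : ℕ} [Fact p.Prime] (S : G3Setup p) (P : PadicG3Par S.n) (b : ℝ)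

/-! ### Nodes in the shape `|x| ≤ 2^{lev+n}·9·HV` -/

/-- k-step nodes: `NS lev (ν+1) ≤ 2^{lev+n}·9·HV` for `ν + 1 ≤ n`. [folklore] -/
theorem NS_Vb_le_HV {lev ν : ℕ} (hν : ν + 1 ≤ S.n) : (S.NS (P.schedVb b) lev (ν + 1) : ℝ) ≤ 2 ^ (lev + S.n) * (9 * P.HV) := by
  have h := S.NS_Vb_real_le P b lev (ν + 1)
  have h9 := P.g_XV_half_le_HV
  have hg : 0 ≤ P.g := le_trans zero_le_one P.one_le_g
  have hX : (0 : ℝ) ≤ P.XV := by positivity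
  have hH : (0 : ℝ) ≤ P.HV := by positivity
  have h2 : (2 : ℝ) ^ (ν + 1) ≤ 2 ^ S.n := pow_le_pow_right₀ (by norm_num) hν
  have h3 : (2 : ℝ) ^ lev * P.g * P.XV / 2 + 1 ≤ 2 ^ lev * (9 * P.HV) := by
    have h1 : (1 : ℝ) ≤ 2 ^ lev := one_le_pow₀ (by norm_num)
    nlinarith
  calc (S.NS (P.schedVb b) lev (ν + 1) : ℝ) ≤ 2 ^ (ν + 1) * (2 ^ lev * P.g * P.XV / 2 + 1) := h
    _ ≤ 2 ^ S.n * (2 ^ lev * (9 * P.HV)) := mul_le_mul h2 h3 (by positivity) (by positivity)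
    _ = 2 ^ (lev + S.n) * (9 * P.HV) := by rw [pow_add]; ring

/-- START nodes: `NS 0 0 ≤ 2^{0+n}·9·HV`. [folklore] -/
theorem NS00_Vb_le_HV : (S.NS (P.schedVb b) 0 0 : ℝ) ≤ 2 ^ (0 + S.n) * (9 * P.HV) := by
  have h := S.NS_Vb_real_le P b 0 0
  have h9 := P.g_XV_half_le_HV
  have hH : (0 : ℝ) ≤ P.HV := by positivity
  have h2 : (1 : ℝ) ≤ 2 ^ (0 + S.n) := one_le_pow₀ (by norm_num)
  simp only [pow_zero, one_mul] at h
  nlinarith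

/-- half-step points: `2·NhS (lev+1) − 1 ≤ 2^{(lev+1)+n}·9·HV` (`n ≥ 1`). [folklore] -/
theorem halfNodes_Vb_le_HV (hn : 1 ≤ S.n) (lev : ℕ) :
    ((2 * (S.NhS (P.schedVb b) (lev + 1) : ℤ) - 1 : ℤ) : ℝ) ≤ 2 ^ ((lev + 1) + S.n) * (9 * P.HV) := by
  rw [S.NhS_Vb P b]
  have h := P.XsV_le (lev + 1)
  have h9 := P.g_XV_half_le_HV
  have hH : (0 : ℝ) ≤ P.HV := by positivity
  have hg : 0 ≤ P.g := le_trans zero_le_one P.one_le_g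
  have hX : (0 : ℝ) ≤ P.XV := by positivity
  have h2 : (2 : ℝ) ≤ 2 ^ S.n := by
    calc (2 : ℝ) = 2 ^ 1 := by norm_num
      _ ≤ 2 ^ S.n := pow_le_pow_right₀ (by norm_num) hn
  have h1 : (1 : ℝ) ≤ 2 ^ (lev + 1) := one_le_pow₀ (by norm_num)
  push_cast
  rw [pow_add]
  nlinarith [mul_le_mul h1 h9 (by positivity) (by positivity), mul_nonneg (sub_nonneg.mpr h1) hH]

/-! ### The class bound `UcardS₂` -/

/-- **`log UcardS₂ ≤ lunkV`** (`2·sideS₂ⱼ + 1 ≤ LV/Aⱼ + 1 ≤ 2 LV`). [folklore] -/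
theorem log_UcardS₂_Vb_le (hb : 1 ≤ b) : Real.log (S.UcardS₂ (P.schedVb b) : ℝ) ≤ P.lunkV := by
  unfold UcardS₂ PadicG3Par.lunkV
  rw [P.schedVb_L₀]
  push_cast
  have hL := P.one_le_LV
  have hL2 : (2 : ℝ) ≤ P.LV := by
    have h : 2 ^ 1 ≤ P.LV := le_trans (Nat.pow_le_pow_right (by norm_num) (by omega)) P.two_pow_le_LV
    exact_mod_cast h
  have hside : ∀ j, 2 * (S.sideS₂ (P.schedVb b) j : ℝ) + 1 ≤ 2 * P.LV := by
    intro j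
    have h := S.sideS₂_Vb_le P b hb j
    have hA := P.hA j
    have hl2 : (2 : ℝ) / 3 < Real.log 2 := by
      have := Real.log_two_gt_d9; linarith
    have hApos := P.A_pos j
    have : (P.LV : ℝ) / (2 * P.A j) ≤ 3 / 4 * P.LV := by
      rw [div_le_iff₀ (by positivity)]; nlinarith
    linarith
  have hpos : ∀ j, (0 : ℝ) < 2 * (S.sideS₂ (P.schedVb b) j : ℝ) + 1 := fun j => by positivity
  rw [Real.log_mul (by positivity) (Finset.prod_pos fun j _ => hpos j).ne', Real.log_prod fun j _ => (hpos j).ne']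
  have hsum : ∑ j, Real.log (2 * (S.sideS₂ (P.schedVb b) j : ℝ) + 1) ≤ ∑ _j : Fin S.n, Real.log (2 * (P.LV : ℝ)) :=
    Finset.sum_le_sum fun j _ => Real.log_le_log (hpos j) (hside j)
  rw [Finset.sum_const, Finset.card_univ, Fintype.card_fin, nsmul_eq_mul] at hsum
  linarith

/-- `1 ≤ UcardS₂`. [folklore] -/
theorem one_le_UcardS₂ (Sc : G3Sched S.n) : 1 ≤ S.UcardS₂ Sc := by
  unfold UcardS₂
  exact Nat.one_le_iff_ne_zero.mpr (Nat.mul_ne_zero (by omega) (Finset.prod_ne_zero_iff.mpr fun j _ => by omega))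

/-! ### The directional bound `XbC` -/

/-- **`XbC (Lb lev) ≤ 2n²·e^W·LV/2^lev`** (`Aⱼ ≥ 1`). [folklore] -/
theorem XbC_Vb_le (hb : 1 ≤ b) (hA1 : ∀ j, 1 ≤ P.A j) (hbW : ∀ j, Real.log (max 3 (|S.b j| : ℝ)) ≤ P.W) (lev : ℕ) :
    (S.XbC (S.Lb (S.sideS₂ (P.schedVb b)) lev) : ℝ) ≤ 2 * S.n ^ 2 * Real.exp P.W * P.LV / 2 ^ lev := by
  have h1 := S.XbC_le hbW (S.Lb (S.sideS₂ (P.schedVb b)) lev)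
  have h2 := S.sum_Lb_Vb_le P b hb hA1 lev
  have h0 : (0 : ℝ) ≤ 2 * S.n * Real.exp P.W := by positivity
  calc (S.XbC (S.Lb (S.sideS₂ (P.schedVb b)) lev) : ℝ) ≤ 2 * S.n * Real.exp P.W * ∑ j, (S.Lb (S.sideS₂ (P.schedVb b)) lev j : ℝ) := h1
    _ ≤ 2 * S.n * Real.exp P.W * (S.n * P.LV / 2 ^ lev) := mul_le_mul_of_nonneg_left h2 h0
    _ = 2 * S.n ^ 2 * Real.exp P.W * P.LV / 2 ^ lev := by ring

/-- The logarithmic directional bound: `XbC (Lb lev) ≤ exp(log 2 + 2 log n + W + log LV)` (`n ≥ 1`). [folklore] -/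
theorem XbC_Vb_le_exp (hb : 1 ≤ b) (hn : 1 ≤ S.n) (hA1 : ∀ j, 1 ≤ P.A j) (hbW : ∀ j, Real.log (max 3 (|S.b j| : ℝ)) ≤ P.W) (lev : ℕ) :
    (S.XbC (S.Lb (S.sideS₂ (P.schedVb b)) lev) : ℝ) ≤ Real.exp (Real.log 2 + 2 * Real.log S.n + P.W + Real.log P.LV) := by
  have h := S.XbC_Vb_le P b hb hA1 hbW lev
  have hn' : (0 : ℝ) < S.n := by exact_mod_cast hn
  have hL : (0 : ℝ) < P.LV := by linarith [P.one_le_LV]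
  have hexp : Real.exp (Real.log 2 + 2 * Real.log S.n + P.W + Real.log P.LV) = 2 * S.n ^ 2 * Real.exp P.W * P.LV := by
    rw [Real.exp_add, Real.exp_add, Real.exp_add, Real.exp_log (by norm_num), Real.exp_log hL,
      show (2 : ℝ) * Real.log S.n = Real.log (S.n ^ 2) by rw [Real.log_pow]; norm_num, Real.exp_log (by positivity)]
  rw [hexp]
  refine h.trans (div_le_self (by positivity) (one_le_pow₀ (by norm_num)))

/-- `0 ≤ XbC L`. [folklore] -/
theorem XbC_nonneg (L : Fin S.n → ℕ) : (0 : ℝ) ≤ (S.XbC L : ℝ) := by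
  have : (0 : ℤ) ≤ S.XbC L := by
    unfold XbC; exact mul_nonneg (by norm_num) (mul_nonneg (sum_nonneg fun j _ => abs_nonneg _) (sum_nonneg fun j _ => by positivity))
  exact_mod_cast this

/-- powers: `XbC (Lb lev)^t ≤ exp(t·(log 2 + 2 log n + W + log LV))`. [folklore] -/
theorem XbC_pow_Vb_le (hb : 1 ≤ b) (hn : 1 ≤ S.n) (hA1 : ∀ j, 1 ≤ P.A j) (hbW : ∀ j, Real.log (max 3 (|S.b j| : ℝ)) ≤ P.W) (lev t : ℕ) :
    (S.XbC (S.Lb (S.sideS₂ (P.schedVb b)) lev) : ℝ) ^ t ≤ Real.exp (t * (Real.log 2 + 2 * Real.log S.n + P.W + Real.log P.LV)) := by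
  rw [Real.exp_nat_mul]
  exact pow_le_pow_left₀ (S.XbC_nonneg _) (S.XbC_Vb_le_exp P b hb hn hA1 hbW lev) t

/-- the START's `XbSS₂ = max 1 (XbC (Lb 0)) ≤ exp(log 2 + 2 log n + W + log LV)`. [folklore] -/
theorem XbSS₂_Vb_le (hb : 1 ≤ b) (hn : 1 ≤ S.n) (hA1 : ∀ j, 1 ≤ P.A j) (hbW : ∀ j, Real.log (max 3 (|S.b j| : ℝ)) ≤ P.W) :
    (S.XbSS₂ (P.schedVb b) : ℝ) ≤ Real.exp (Real.log 2 + 2 * Real.log S.n + P.W + Real.log P.LV) := by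
  unfold XbSS₂
  push_cast
  refine max_le ?_ ?_
  · refine Real.one_le_exp ?_
    have h1 : 0 ≤ Real.log 2 := Real.log_nonneg (by norm_num)
    have h2 : 0 ≤ Real.log (S.n : ℝ) := Real.log_nonneg (by exact_mod_cast hn)
    have h3 : 0 ≤ Real.log (P.LV : ℝ) := Real.log_nonneg P.one_le_LV
    linarith [P.hW]
  · have h := S.XbC_Vb_le_exp P b hb hn hA1 hbW 0
    simpa using h

/-! ### Monomial denominators of the box -/

/-- **`log monDen(α, boxExpG (Lb lev) x) ≤ 2|x|·(n·LV/2^lev)`** (`h(αⱼ) ≤ Aⱼ`). [cite: Nesterenko2003, §3.2; shape only] -/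
theorem log_monDen_box_Vb_le (hb : 1 ≤ b) (hαA : ∀ j, Height.logHeight₁ (S.α j) ≤ P.A j) (lev : ℕ) (x : ℤ) :
    Real.log (MonomialDen.monDen S.α (S.boxExpG (S.Lb (S.sideS₂ (P.schedVb b)) lev) x) : ℝ) ≤ 2 * |(x : ℝ)| * (S.n * P.LV / 2 ^ lev) := by
  have h1 := S.log_monDen_boxExpG_le (S.Lb (S.sideS₂ (P.schedVb b)) lev) x
  have h2 : ∑ j, (S.Lb (S.sideS₂ (P.schedVb b)) lev j : ℝ) * Height.logHeight₁ (S.α j) ≤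
      ∑ j, (S.Lb (S.sideS₂ (P.schedVb b)) lev j : ℝ) * P.A j :=
    Finset.sum_le_sum fun j _ => mul_le_mul_of_nonneg_left (hαA j) (by positivity)
  have h3 := S.sum_Lb_mul_A_Vb_le P b hb lev
  have h0 : (0 : ℝ) ≤ 2 * |(x : ℝ)| := by positivity
  nlinarith [mul_le_mul_of_nonneg_left (h2.trans h3) h0]

/-- k-step nodes: `2·NS lev (ν+1)·(n LV/2^lev) ≤ 2·htsV ν`. [folklore] -/
theorem nodes_height_Vb_le (lev ν : ℕ) : 2 * (S.NS (P.schedVb b) lev (ν + 1) : ℝ) * (S.n * P.LV / 2 ^ lev) ≤ 2 * P.htsV ν := by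
  have h := S.NS_Vb_real_le P b lev (ν + 1)
  unfold PadicG3Par.htsV
  have hg : 0 ≤ P.g := le_trans zero_le_one P.one_le_g
  have hX : (0 : ℝ) ≤ P.XV := by positivity
  have hL : (0 : ℝ) ≤ P.LV := by positivity
  have hn : (0 : ℝ) ≤ S.n := by positivity
  have h2l : (0 : ℝ) < 2 ^ lev := by positivity
  -- `NS/2^lev ≤ 2^{ν+1} (g XV/2 + 1)`
  have hdiv : (S.NS (P.schedVb b) lev (ν + 1) : ℝ) / 2 ^ lev ≤ 2 ^ (ν + 1) * (P.g * P.XV / 2 + 1) := by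
    rw [div_le_iff₀ h2l]
    have h1 : (1 : ℝ) ≤ 2 ^ lev := one_le_pow₀ (by norm_num)
    have h2ν : (0 : ℝ) ≤ 2 ^ (ν + 1) := by positivity
    nlinarith [mul_nonneg h2ν (sub_nonneg.mpr h1)]
  have e : 2 * (S.NS (P.schedVb b) lev (ν + 1) : ℝ) * (S.n * P.LV / 2 ^ lev) =
      2 * ((S.NS (P.schedVb b) lev (ν + 1) : ℝ) / 2 ^ lev) * (S.n * P.LV) := by
    field_simp
  rw [e, pow_succ] at *
  nlinarith [mul_le_mul_of_nonneg_right hdiv (by positivity : (0 : ℝ) ≤ S.n * P.LV)]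

/-- START nodes: `2·NS 0 0·(n LV) ≤ htsV 0`. [folklore] -/
theorem start_height_Vb_le : 2 * (S.NS (P.schedVb b) 0 0 : ℝ) * (S.n * P.LV) ≤ P.htsV 0 := by
  have h := S.NS_Vb_real_le P b 0 0
  unfold PadicG3Par.htsV
  simp only [pow_zero, one_mul] at h ⊢
  have hn : (0 : ℝ) ≤ S.n * P.LV := by positivity
  nlinarith [mul_le_mul_of_nonneg_right h hn]

/-- half-step points: `2|s₁|·Σⱼ Lb lev j·h(αⱼ) ≤ 4·htsV 0` for `|s₁| ≤ 2·NhS (lev+1) − 1`. [folklore] -/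
theorem half_height_Vb_le (hb : 1 ≤ b) (hαA : ∀ j, Height.logHeight₁ (S.α j) ≤ P.A j) (lev : ℕ) {s₁ : ℤ}
    (hs : |s₁| ≤ (2 * (S.NhS (P.schedVb b) (lev + 1) : ℤ) - 1 : ℤ)) :
    2 * |(s₁ : ℝ)| * ∑ j, (S.Lb (S.sideS₂ (P.schedVb b)) lev j : ℝ) * Height.logHeight₁ (S.α j) ≤ 4 * P.htsV 0 := by
  have h2 : ∑ j, (S.Lb (S.sideS₂ (P.schedVb b)) lev j : ℝ) * Height.logHeight₁ (S.α j) ≤ S.n * P.LV / 2 ^ lev :=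
    le_trans (Finset.sum_le_sum fun j _ => mul_le_mul_of_nonneg_left (hαA j) (by positivity)) (S.sum_Lb_mul_A_Vb_le P b hb lev)
  rw [S.NhS_Vb P b] at hs
  have hs' : |(s₁ : ℝ)| ≤ 2 * (P.XsV (lev + 1) : ℝ) - 1 := by
    have : ((|s₁| : ℤ) : ℝ) ≤ ((2 * (P.XsV (lev + 1) : ℤ) - 1 : ℤ) : ℝ) := by exact_mod_cast hs
    push_cast at this
    exact this
  have hX := P.XsV_le (lev + 1)
  unfold PadicG3Par.htsV
  have hg : 0 ≤ P.g := le_trans zero_le_one P.one_le_g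
  have hXV : (0 : ℝ) ≤ P.XV := by positivity
  have hnL : (0 : ℝ) ≤ S.n * P.LV := by positivity
  have h2l : (0 : ℝ) < 2 ^ lev := by positivity
  have habs : (0 : ℝ) ≤ |(s₁ : ℝ)| := abs_nonneg _
  -- `|s₁|/2^lev ≤ 2 g XV + 1`
  have hdiv : |(s₁ : ℝ)| * (S.n * P.LV / 2 ^ lev) ≤ (2 * P.g * P.XV + 1) * (S.n * P.LV) := by
    have h1 : |(s₁ : ℝ)| ≤ 2 ^ lev * (2 * P.g * P.XV + 1) := by
      have h1' : (1 : ℝ) ≤ 2 ^ lev := one_le_pow₀ (by norm_num)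
      rw [pow_succ] at hX
      nlinarith
    calc |(s₁ : ℝ)| * (S.n * P.LV / 2 ^ lev) = |(s₁ : ℝ)| / 2 ^ lev * (S.n * P.LV) := by field_simp
      _ ≤ (2 * P.g * P.XV + 1) * (S.n * P.LV) := by
          refine mul_le_mul_of_nonneg_right ?_ hnL
          rw [div_le_iff₀ h2l]; linarith
  simp only [pow_zero, one_mul]
  nlinarith [mul_le_mul_of_nonneg_left h2 (by positivity : (0 : ℝ) ≤ 2 * |(s₁ : ℝ)|)]

/-! ### The `L₀`-factor of `M0C` -/

/-- `L0V·(1 + log(1 + 2^{Ŝ−lev}|x|/HV)) ≤ L0V·(ŜG + n + 6)·log 2` for `|x| ≤ 2^{lev+n}·9·HV`, `lev ≤ ŜG`. [folklore] -/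
theorem L0_factor_Vb_le {lev : ℕ} (hlev : lev ≤ P.SdG) {x : ℤ} (hx : (|x| : ℝ) ≤ 2 ^ (lev + S.n) * (9 * P.HV)) :
    (P.L0V : ℝ) * (1 + Real.log (1 + |((2 ^ (P.SdG - lev) * x : ℤ) : ℝ)| / P.HV)) ≤ P.L0V * ((P.SdG + S.n + 6) * Real.log 2) := by
  have hH : (1 : ℝ) ≤ P.HV := by exact_mod_cast P.one_le_HV
  have hcast : |((2 ^ (P.SdG - lev) * x : ℤ) : ℝ)| = 2 ^ (P.SdG - lev) * |(x : ℝ)| := by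
    push_cast; rw [abs_mul, abs_of_nonneg (by positivity : (0 : ℝ) ≤ 2 ^ (P.SdG - lev))]
  rw [hcast]
  have hratio : 2 ^ (P.SdG - lev) * |(x : ℝ)| / P.HV ≤ 9 * 2 ^ (P.SdG + S.n) := by
    rw [div_le_iff₀ (by linarith)]
    have e : (2 : ℝ) ^ (P.SdG - lev) * (2 ^ (lev + S.n) * (9 * P.HV)) = 9 * 2 ^ (P.SdG + S.n) * P.HV := by
      rw [show P.SdG + S.n = (P.SdG - lev) + (lev + S.n) by omega, pow_add]; ring
    calc (2 : ℝ) ^ (P.SdG - lev) * |(x : ℝ)| ≤ 2 ^ (P.SdG - lev) * (2 ^ (lev + S.n) * (9 * P.HV)) :=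
          mul_le_mul_of_nonneg_left hx (by positivity)
      _ = 9 * 2 ^ (P.SdG + S.n) * P.HV := e
  have h1 : 1 + 2 ^ (P.SdG - lev) * |(x : ℝ)| / P.HV ≤ 2 ^ (P.SdG + S.n + 4) := by
    have h16 : (1 : ℝ) ≤ 2 ^ (P.SdG + S.n) := one_le_pow₀ (by norm_num)
    have e4 : (2 : ℝ) ^ (P.SdG + S.n + 4) = 2 ^ (P.SdG + S.n) * 16 := by rw [pow_add]; norm_num
    rw [e4]
    linarith
  have hpos : 0 < 1 + 2 ^ (P.SdG - lev) * |(x : ℝ)| / P.HV := by positivity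
  have hlog : Real.log (1 + 2 ^ (P.SdG - lev) * |(x : ℝ)| / P.HV) ≤ (P.SdG + S.n + 4) * Real.log 2 := by
    calc Real.log (1 + 2 ^ (P.SdG - lev) * |(x : ℝ)| / P.HV) ≤ Real.log (2 ^ (P.SdG + S.n + 4)) := Real.log_le_log hpos h1
      _ = (P.SdG + S.n + 4) * Real.log 2 := by rw [Real.log_pow]; push_cast; ring
  have hl2 : (1 : ℝ) ≤ 2 * Real.log 2 := by have := Real.log_two_gt_d9; linarith
  have hL0 : (0 : ℝ) ≤ P.L0V := by positivity
  refine mul_le_mul_of_nonneg_left ?_ hL0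
  linarith

/-- **`M0C ≤ exp(log 2 + t₀·(ŜG·log 2 + (23/20)HV) + HV/e + L0V(ŜG+n+6) log 2)`** at admissible nodes. [cite: Nesterenko2003, (3.8); shape only] -/
theorem M0C_Vb_le_exp {lev : ℕ} (hlev : lev ≤ P.SdG) {x : ℤ} (hx : (|x| : ℝ) ≤ 2 ^ (lev + S.n) * (9 * P.HV)) (t₀ : ℕ) :
    (M0C P.L0V P.HV P.SdG lev x t₀ : ℝ) ≤ Real.exp (Real.log 2 + t₀ * (P.SdG * Real.log 2 + 23 / 20 * P.HV) + P.HV / Real.exp 1 +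
      P.L0V * ((P.SdG + S.n + 6) * Real.log 2)) := by
  have h := log_M0C_le_sharp P.L0V P.HV P.SdG lev x t₀
  have hL := S.L0_factor_Vb_le P hlev hx
  have hS : ((P.SdG - lev : ℕ) : ℝ) ≤ P.SdG := by exact_mod_cast Nat.sub_le _ _
  have ht0 : (0 : ℝ) ≤ t₀ := by positivity
  have hl2 : 0 ≤ Real.log 2 := Real.log_nonneg (by norm_num)
  have hMpos := M0C_pos P.L0V P.HV P.SdG lev x t₀
  rw [← Real.exp_log hMpos]
  refine Real.exp_le_exp.mpr (h.trans ?_)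
  nlinarith [mul_le_mul_of_nonneg_right hS (mul_nonneg ht0 hl2)]

end G3Setup

end Summit.ABC.StewartYu

end
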